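import Literature.RingTheory.MvPolynomial.NoetherFormsToolkit
import Mathlib.Algebra.Polynomial.EraseLead
import Mathlib.RingTheory.AdjoinRoot
import HarnessLib

/-!
# Norm bookkeeping for Kaltofen's coefficient-growth analysis (tools)

Support file for the proof of Kaltofen's Theorem 7 (`kaltofen1995_thm7`; E. Kaltofen, *Effective
Noether irreducibility forms and applications*, J. Comput. System Sci. 50 (1995) 274–295), more
precisely for the NORM half of his §3 "Coefficient Growth Analysis" (Lemma 1, Thms. 1, 2, 4:
`‖·‖₁` of every intermediate quantity of the absolute irreducibility test run on the generic
polynomial), applied to the objects of `KaltofenTestDefs` in the sibling files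
`KaltofenBoundsGeneric*`. The degree half is `KaltofenBoundsDegreeTools`.

We use the weighted `ℓ¹`-norms `polyNorm p t` of `NoetherFormsToolkit`. Kaltofen's Lemma 1
(p. 11 of the paper) controls the growth of `‖·‖₁` under reduction modulo the monic
`f₀(z) = z^d + Σ c_{i,0} zⁱ`; with the weight `t = 2` for `z` the norm `‖f₀ − z^d‖ = 2^d − 1 ≤ 2^d`
and reduction modulo `f₀` does not increase the weighted norm at all:

* `polyNorm_modByMonic_le`: for `f` monic with `polyNorm p t (f − X^{deg f}) ≤ t^{deg f}`,
  `polyNorm p t (P %ₘ f) ≤ polyNorm p t P` (Kaltofen's Lemma 1, valuation form).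
* `rSeminorm p ht hf hfn : RingSeminorm (AdjoinRoot f)`: `polyNorm p t` of the canonical
  representative — subadditive AND submultiplicative, so that the toolkit's `polyNorm` may be
  iterated once more over `(A[σ][z]/(f))[Y]` (with a small weight for `Y`: the majorant device
  behind Kaltofen's Thm. 1).

Everything here is [folklore]; no cited statements, no named facts.

## References

* E. Kaltofen, J. Comput. System Sci. 50 (1995) 274–295, §3 Lemma 1, Thm. 1. [Kaltofen1995]
-/

noncomputable section

open Polynomial

namespace Literature.RingTheory.MvPolynomial.KaltofenBounds

open Literature.RingTheory.MvPolynomial.NoetherForms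

universe u

variable {R : Type u} [CommRing R] (p : RingSeminorm R) {t : ℝ}

/-! ### Weighted norm and the leading term -/

/-- Subadditivity of `polyNorm` for differences. [folklore] -/
theorem polyNorm_sub_le (ht : 0 ≤ t) (P Q : R[X]) :
    polyNorm p t (P - Q) ≤ polyNorm p t P + polyNorm p t Q := by
  rw [sub_eq_add_neg]
  refine (polyNorm_add_le p ht _ _).trans ?_
  rw [polyNorm_neg]

/-- Removing the leading term removes exactly its contribution to the weighted norm. [folklore] -/
theorem polyNorm_eraseLead_add (t : ℝ) (P : R[X]) (hP : P ≠ 0) :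
    polyNorm p t P.eraseLead + p P.leadingCoeff * t ^ P.natDegree = polyNorm p t P := by
  classical
  unfold polyNorm
  rw [Polynomial.eraseLead_support, ← Finset.add_sum_erase P.support
    (fun i => p (P.coeff i) * t ^ i) (Polynomial.natDegree_mem_support_of_nonzero hP), add_comm]
  congr 1
  refine Finset.sum_congr rfl fun i hi => ?_
  rw [Polynomial.eraseLead_coeff_of_ne i (Finset.ne_of_mem_erase hi)]

/-- **Kaltofen's Lemma 1, valuation form (norms).** If `f` is monic and the weighted norm of its
tail is at most the weight of its leading term, reduction modulo `f` does not increase the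
weighted norm. [cite: Kaltofen1995, §3 Lemma 1] -/
theorem polyNorm_modByMonic_le (ht : 0 ≤ t) {f : R[X]} (hf : f.Monic)
    (hfn : polyNorm p t (f - X ^ f.natDegree) ≤ t ^ f.natDegree) (P : R[X]) :
    polyNorm p t (P %ₘ f) ≤ polyNorm p t P := by
  rcases subsingleton_or_nontrivial R with hR | hR
  · rw [Subsingleton.elim (P %ₘ f) P]
  induction hn : P.natDegree using Nat.strong_induction_on generalizing P with
  | _ n ih =>
    by_cases hlt : P.degree < f.degree
    · rw [(Polynomial.modByMonic_eq_self_iff hf).2 hlt]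
    by_cases hP0 : P = 0
    · rw [hP0, Polynomial.zero_modByMonic]
    have hle : f.degree ≤ P.degree := not_lt.1 hlt
    set P' := P - f * (C P.leadingCoeff * X ^ (P.natDegree - f.natDegree)) with hP'
    have hdeg : P'.degree < P.degree := Polynomial.div_wf_lemma ⟨hle, hP0⟩ hf
    have hmod : P %ₘ f = P' %ₘ f :=
      Polynomial.modByMonic_eq_of_dvd_sub hf (by rw [hP', sub_sub_cancel]; exact dvd_mul_right _ _)
    have hnat : f.natDegree ≤ P.natDegree := Polynomial.natDegree_le_natDegree hle
    -- the division step does not increase the norm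
    have hwP' : polyNorm p t P' ≤ polyNorm p t P := by
      have hsplit : P' = P.eraseLead -
          (f - X ^ f.natDegree) * (C P.leadingCoeff * X ^ (P.natDegree - f.natDegree)) := by
        rw [hP', ← Polynomial.self_sub_C_mul_X_pow, sub_mul, mul_comm (X ^ f.natDegree), mul_assoc,
          ← pow_add, Nat.sub_add_cancel hnat]
        ring
      have hmono : polyNorm p t (C P.leadingCoeff * X ^ (P.natDegree - f.natDegree)) =
          p P.leadingCoeff * t ^ (P.natDegree - f.natDegree) := by
        rw [Polynomial.C_mul_X_pow_eq_monomial, polyNorm_monomial]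
      have h1 := polyNorm_sub_le p ht P.eraseLead
        ((f - X ^ f.natDegree) * (C P.leadingCoeff * X ^ (P.natDegree - f.natDegree)))
      have h2 := polyNorm_mul_le p ht (f - X ^ f.natDegree)
        (C P.leadingCoeff * X ^ (P.natDegree - f.natDegree))
      have h3 := polyNorm_eraseLead_add p t P hP0
      have hlc : 0 ≤ p P.leadingCoeff * t ^ (P.natDegree - f.natDegree) :=
        mul_nonneg (apply_nonneg p _) (pow_nonneg ht _)
      have h4 : polyNorm p t (f - X ^ f.natDegree) * (p P.leadingCoeff * t ^ (P.natDegree - f.natDegree))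
          ≤ t ^ f.natDegree * (p P.leadingCoeff * t ^ (P.natDegree - f.natDegree)) :=
        mul_le_mul_of_nonneg_right hfn hlc
      have h5 : t ^ f.natDegree * (p P.leadingCoeff * t ^ (P.natDegree - f.natDegree)) =
          p P.leadingCoeff * t ^ P.natDegree := by
        rw [mul_left_comm, ← pow_add, Nat.add_sub_cancel' hnat]
      rw [hsplit]
      rw [hmono] at h2
      linarith
    rw [hmod]
    by_cases hP'0 : P' = 0
    · rw [hP'0, Polynomial.zero_modByMonic, polyNorm_zero]; exact polyNorm_nonneg p ht P
    have hlt' : P'.natDegree < n := by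
      rw [← hn]; exact Polynomial.natDegree_lt_natDegree hP'0 hdeg
    exact (ih _ hlt' P' rfl).trans hwP'

/-! ### The induced ring seminorm on `R[z]/(f)` -/

section RNorm

variable {f : R[X]}

/-- `rnorm p t hf a` = weighted norm of the canonical representative of `a ∈ R[z]/(f)`. [folklore] -/
def rnorm (p : RingSeminorm R) (t : ℝ) (hf : f.Monic) (a : AdjoinRoot f) : ℝ :=
  polyNorm p t (AdjoinRoot.modByMonicHom hf a)

variable (hf : f.Monic)

/-- `rnorm (mk P) ≤ ‖P‖` (Kaltofen's Lemma 1). [cite: Kaltofen1995, §3 Lemma 1] -/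
theorem rnorm_mk_le (ht : 0 ≤ t) (hfn : polyNorm p t (f - X ^ f.natDegree) ≤ t ^ f.natDegree) (P : R[X]) :
    rnorm p t hf (AdjoinRoot.mk f P) ≤ polyNorm p t P := by
  unfold rnorm; rw [AdjoinRoot.modByMonicHom_mk]; exact polyNorm_modByMonic_le p ht hf hfn P

/-- Submultiplicativity of `rnorm`. [cite: Kaltofen1995, §3 Lemma 1] -/
theorem rnorm_mul_le (ht : 0 ≤ t) (hfn : polyNorm p t (f - X ^ f.natDegree) ≤ t ^ f.natDegree)
    (a b : AdjoinRoot f) : rnorm p t hf (a * b) ≤ rnorm p t hf a * rnorm p t hf b := by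
  have ha := AdjoinRoot.mk_leftInverse hf a
  have hb := AdjoinRoot.mk_leftInverse hf b
  conv_lhs => rw [← ha, ← hb, ← map_mul]
  exact (rnorm_mk_le p hf ht hfn _).trans (polyNorm_mul_le p ht _ _)

/-- `rnorm` as a ring seminorm on `R[z]/(f)`. [folklore] -/
def rSeminorm (p : RingSeminorm R) {t : ℝ} (ht : 0 ≤ t) {f : R[X]} (hf : f.Monic)
    (hfn : polyNorm p t (f - X ^ f.natDegree) ≤ t ^ f.natDegree) : RingSeminorm (AdjoinRoot f) where
  toFun := rnorm p t hf
  map_zero' := by simp [rnorm]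
  add_le' a b := by
    simp only [rnorm, map_add]
    exact polyNorm_add_le p ht _ _
  neg' a := by simp only [rnorm, map_neg, polyNorm_neg]
  mul_le' a b := rnorm_mul_le p hf ht hfn a b

/-- Unfolding `rSeminorm`. [folklore] -/
@[simp] theorem rSeminorm_apply (ht : 0 ≤ t) (hfn : polyNorm p t (f - X ^ f.natDegree) ≤ t ^ f.natDegree)
    (a : AdjoinRoot f) : rSeminorm p ht hf hfn a = rnorm p t hf a := rfl

/-- `rnorm` is non-negative. [folklore] -/
theorem rnorm_nonneg (ht : 0 ≤ t) (a : AdjoinRoot f) : 0 ≤ rnorm p t hf a :=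
  polyNorm_nonneg p ht _

/-- Scalars: `rnorm (of c) ≤ p c`. [folklore] -/
theorem rnorm_of_le (ht : 0 ≤ t) (hfn : polyNorm p t (f - X ^ f.natDegree) ≤ t ^ f.natDegree) (c : R) :
    rnorm p t hf (AdjoinRoot.of f c) ≤ p c := by
  rw [← AdjoinRoot.mk_C]
  exact (rnorm_mk_le p hf ht hfn _).trans (by rw [polyNorm_C])

/-- Scalars through `algebraMap`. [folklore] -/
theorem rnorm_algebraMap_le (ht : 0 ≤ t) (hfn : polyNorm p t (f - X ^ f.natDegree) ≤ t ^ f.natDegree)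
    (c : R) : rnorm p t hf (algebraMap R (AdjoinRoot f) c) ≤ p c := by
  rw [AdjoinRoot.algebraMap_eq]; exact rnorm_of_le p hf ht hfn c

/-- The root: `rnorm z̄ ≤ p 1 · t`. [folklore] -/
theorem rnorm_root_le (ht : 0 ≤ t) (hfn : polyNorm p t (f - X ^ f.natDegree) ≤ t ^ f.natDegree) :
    rnorm p t hf (AdjoinRoot.root f) ≤ p 1 * t := by
  rw [← AdjoinRoot.mk_X]
  refine (rnorm_mk_le p hf ht hfn _).trans ?_
  rw [← Polynomial.monomial_one_one_eq_X, polyNorm_monomial, pow_one]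

/-- `rnorm 1 ≤ p 1`. [folklore] -/
theorem rnorm_one_le (ht : 0 ≤ t) (hfn : polyNorm p t (f - X ^ f.natDegree) ≤ t ^ f.natDegree) :
    rnorm p t hf 1 ≤ p 1 := by
  have h := rnorm_of_le p hf ht hfn 1
  rwa [map_one] at h

/-- Integer constants: `rnorm n ≤ p n`. [folklore] -/
theorem rnorm_intCast_le (ht : 0 ≤ t) (hfn : polyNorm p t (f - X ^ f.natDegree) ≤ t ^ f.natDegree)
    (n : ℤ) : rnorm p t hf (n : AdjoinRoot f) ≤ p (n : R) := by
  have h := rnorm_of_le p hf ht hfn (n : R)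
  rwa [map_intCast] at h

/-- Natural-number constants: `rnorm n ≤ p n`. [folklore] -/
theorem rnorm_natCast_le (ht : 0 ≤ t) (hfn : polyNorm p t (f - X ^ f.natDegree) ≤ t ^ f.natDegree)
    (n : ℕ) : rnorm p t hf (n : AdjoinRoot f) ≤ p (n : R) := by
  have h := rnorm_of_le p hf ht hfn (n : R)
  rwa [map_natCast] at h

/-- Each weighted coefficient of the canonical representative is dominated by `rnorm`. [folklore] -/
theorem coeff_mul_le_rnorm (ht : 0 ≤ t) (a : AdjoinRoot f) (j : ℕ) :
    p ((AdjoinRoot.modByMonicHom hf a).coeff j) * t ^ j ≤ rnorm p t hf a :=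
  le_polyNorm p ht _ j

/-- With weight `t ≥ 1`, each coefficient of the canonical representative is dominated by `rnorm`.
[folklore] -/
theorem coeff_le_rnorm (ht : 1 ≤ t) (a : AdjoinRoot f) (j : ℕ) :
    p ((AdjoinRoot.modByMonicHom hf a).coeff j) ≤ rnorm p t hf a := by
  have h := coeff_mul_le_rnorm p hf (zero_le_one.trans ht) a j
  have h1 : 1 ≤ t ^ j := one_le_pow₀ ht
  have h0 : 0 ≤ p ((AdjoinRoot.modByMonicHom hf a).coeff j) := apply_nonneg p _
  nlinarith

/-- Powers: `rnorm (aⁿ) ≤ (rnorm a)ⁿ` when `p 1 ≤ 1`. [folklore] -/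
theorem rnorm_pow_le (ht : 0 ≤ t) (hfn : polyNorm p t (f - X ^ f.natDegree) ≤ t ^ f.natDegree)
    (h1 : p 1 ≤ 1) (a : AdjoinRoot f) (n : ℕ) : rnorm p t hf (a ^ n) ≤ rnorm p t hf a ^ n := by
  induction n with
  | zero => rw [pow_zero, pow_zero]; exact (rnorm_one_le p hf ht hfn).trans h1
  | succ n ih =>
    rw [pow_succ, pow_succ]
    exact (rnorm_mul_le p hf ht hfn _ _).trans
      (mul_le_mul_of_nonneg_right ih (rnorm_nonneg p hf ht a))

/-- Finite sums. [folklore] -/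
theorem rnorm_sum_le (ht : 0 ≤ t) {ι : Type*} (s : Finset ι) (g : ι → AdjoinRoot f) :
    rnorm p t hf (∑ i ∈ s, g i) ≤ ∑ i ∈ s, rnorm p t hf (g i) := by
  unfold rnorm; rw [map_sum]; exact polyNorm_sum_le p ht _ _

/-- Finite products when `p 1 ≤ 1`. [folklore] -/
theorem rnorm_prod_le (ht : 0 ≤ t) (hfn : polyNorm p t (f - X ^ f.natDegree) ≤ t ^ f.natDegree)
    (h1 : p 1 ≤ 1) {ι : Type*} (s : Finset ι) (g : ι → AdjoinRoot f) :
    rnorm p t hf (∏ i ∈ s, g i) ≤ ∏ i ∈ s, rnorm p t hf (g i) := by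
  classical
  induction s using Finset.induction_on with
  | empty => rw [Finset.prod_empty, Finset.prod_empty]; exact (rnorm_one_le p hf ht hfn).trans h1
  | insert i s hi ih =>
    rw [Finset.prod_insert hi, Finset.prod_insert hi]
    exact (rnorm_mul_le p hf ht hfn _ _).trans
      (mul_le_mul (le_refl _) ih (rnorm_nonneg p hf ht _) (rnorm_nonneg p hf ht _))

/-- Powers of the root: `rnorm z̄ʲ ≤ tʲ` when `p 1 ≤ 1`. [folklore] -/
theorem rnorm_root_pow_le (ht : 0 ≤ t) (hfn : polyNorm p t (f - X ^ f.natDegree) ≤ t ^ f.natDegree)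
    (h1 : p 1 ≤ 1) (j : ℕ) : rnorm p t hf (AdjoinRoot.root f ^ j) ≤ t ^ j := by
  refine (rnorm_pow_le p hf ht hfn h1 _ j).trans (pow_le_pow_left₀ (rnorm_nonneg p hf ht _) ?_ j)
  refine (rnorm_root_le p hf ht hfn).trans ?_
  calc p 1 * t ≤ 1 * t := mul_le_mul_of_nonneg_right h1 ht
    _ = t := one_mul t

end RNorm

end Literature.RingTheory.MvPolynomial.KaltofenBounds

end
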